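import Literature.MathematicalPhysics.QuantumManyBody.PeriodicKyFanGapRayleigh
import Literature.MathematicalPhysics.QuantumManyBody.PeriodicFeynmanKacPerronFrobenius
import Literature.MathematicalPhysics.QuantumManyBody.PeriodicHeatFlowSpectral
import Literature.MathematicalPhysics.QuantumManyBody.PeriodicGroundStateNondegenerate
import HarnessLib

/-!
# The Ky Fan gap of the periodic `N`-body Hamiltonian from a Feynman–Kac ground state

Topic `Literature/MathematicalPhysics/QuantumManyBody`; theorems only (no definition, no named
fact). For a measurable pair potential `v` with BOUNDED periodisation `v^per ≤ C` on the torus of side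
`L > 0`, a Feynman–Kac ground state `Ψ₀` (`IsPeriodicGroundStateFK v L Ψ₀` of
`PeriodicHeatFlowSpectral.lean`: the pointwise eigen-relation `e^{-tH}Ψ₀ = e^{-E₀t}Ψ₀` with the
VARIATIONAL energy `E₀ = periodicGroundStateEnergy v N L`, `Ψ₀ ≥ 0`, `∫_cell Ψ₀² = 1`) forces a gap in
Ky Fan form: **`2E₀ + γ ≤ kyFanTwo v N L` for some `γ > 0`**
(`IsPeriodicGroundStateFK.exists_kyFanGap`). Consequently the named fact
`PeriodicGroundStateFeynmanKac` implies the named fact `PeriodicGroundStateNondegenerate`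
(`periodicGroundStateNondegenerate_of_periodicGroundStateFeynmanKac`).

Proof (Reed–Simon IV §XIII.12, run on the torus Feynman–Kac semigroup `T_t = pfkL2 v L t` of
`PeriodicFeynmanKacOperator*.lean`, compact self-adjoint positive and positivity improving):
* the `L²(cell)` class `ψ₀` of `Ψ₀` is a unit eigenvector of `T_t` for `e^{-E₀t}`
  (`IsPeriodicGroundStateFK.pfkL2_toLp`); the Perron–Frobenius vector of `T_t` (`pfkL2_perronFrobenius`,
  a.e. `> 0`, spanning the `‖T_t‖`-eigenspace) is not orthogonal to `ψ₀ ≥ 0`, so `‖T_t‖ = e^{-E₀t}` and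
  that eigenspace is `ℝψ₀` (`IsPeriodicGroundStateFK.opNorm_pfkL2`);
* compactness gives the gap `‖T₁x‖ ≤ M₁‖x‖`, `M₁ < e^{-E₀}`, on `ψ₀^⊥` (`exists_gap_of_simple` of the
  tree), transported to the dyadic times `t = 2^{-m}` by log-convexity
  `⟨T_{t/2}x, x⟩² ≤ ⟨T_t x, x⟩` (`inner_le_rpow_of_comp_sq`): `⟨T_t x, x⟩ ≤ e^{-(E₀+γ)t}‖x‖²` on `ψ₀^⊥`,
  `e^{-(E₀+γ)} = max(M₁, e^{-E₀}/2)`;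
* splitting `f = ⟨ψ₀,f⟩ψ₀ + x` gives the two-level Rayleigh bound of
  `PeriodicKyFanGapRayleigh.lean`, whose `ofReal_le_kyFanTwo_of_twoLevel` (small-time form bound +
  Bessel) concludes.

## References

* M. Reed, B. Simon, *Methods of Modern Mathematical Physics IV* (1978), §XIII.12, Thms XIII.43–44
  and the remark after the Corollary to Thm XIII.46 (ground states of Bose systems are nondegenerate);
  Thm. XIII.1–2 (min–max). [ReedSimonIV1978]
* K. L. Chung, Z. Zhao, *From Brownian Motion to Schrödinger's Equation* (1995), §3.2, Thm 3.10,
  Prop 3.15, Thm 3.27. [ChungZhao1995]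
-/

noncomputable section

namespace Literature.MathematicalPhysics.QuantumManyBody.BoseGas

open MeasureTheory Filter Set
open scoped ENNReal NNReal Topology InnerProductSpace

variable {N : ℕ}

/-! ### Two abstract lemmas on positive symmetric operators -/

section Abstract

variable {E : Type*} [NormedAddCommGroup E] [InnerProductSpace ℝ E]

/-- **Splitting the Rayleigh quotient along a unit eigenvector** of a symmetric operator:
with `T e = μ e`, `‖e‖ = 1`, `a = ⟪e, φ⟫` and `x = φ - a e`, one has `⟪T φ, φ⟫ = μ a² + ⟪T x, x⟫`,
`x ⊥ e` and `‖x‖² = ‖φ‖² - a²`. [folklore] -/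
theorem inner_map_self_eq_of_eigenvector (T : E →L[ℝ] E) (hsym : ∀ x y, ⟪T x, y⟫_ℝ = ⟪x, T y⟫_ℝ)
    {e : E} (he : ‖e‖ = 1) {μ : ℝ} (hTe : T e = μ • e) (φ : E) :
    ⟪T φ, φ⟫_ℝ = μ * ⟪e, φ⟫_ℝ ^ 2 + ⟪T (φ - ⟪e, φ⟫_ℝ • e), φ - ⟪e, φ⟫_ℝ • e⟫_ℝ ∧
      ⟪e, φ - ⟪e, φ⟫_ℝ • e⟫_ℝ = 0 ∧ ‖φ - ⟪e, φ⟫_ℝ • e‖ ^ 2 = ‖φ‖ ^ 2 - ⟪e, φ⟫_ℝ ^ 2 := by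
  have hee : ⟪e, e⟫_ℝ = 1 := by rw [real_inner_self_eq_norm_sq, he, one_pow]
  have hTφe : ⟪T φ, e⟫_ℝ = μ * ⟪e, φ⟫_ℝ := by
    rw [hsym, hTe, inner_smul_right, real_inner_comm]
  have hTeφ : ⟪T e, φ⟫_ℝ = μ * ⟪e, φ⟫_ℝ := by rw [hTe, inner_smul_left]; simp
  have hTee : ⟪T e, e⟫_ℝ = μ := by rw [hTe, inner_smul_left, hee]; simp
  refine ⟨?_, ?_, ?_⟩
  · rw [map_sub, map_smul, inner_sub_left, inner_sub_right, inner_sub_right, inner_smul_left,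
      inner_smul_left, inner_smul_right, inner_smul_right, hTφe, hTeφ, hTee]
    simp only [conj_trivial]
    ring
  · rw [inner_sub_right, inner_smul_right, hee, mul_one, sub_self]
  · rw [@norm_sub_sq_real, inner_smul_right, real_inner_comm, norm_smul, he, mul_one,
      Real.norm_eq_abs, sq_abs]
    ring

/-- **Log-convexity along a dyadic chain.** If `S m = S (m+1) ∘ S (m+1)` for symmetric operators
`S m` (think `S m = e^{-2^{-m}H}`), then for a unit vector `x`,
`⟪S m x, x⟫ ≤ ⟪S 0 x, x⟫ ^ (2^{-m})` (`⟪S_{m+1} x, x⟫ ≤ ‖S_{m+1} x‖ = ⟪S m x, x⟫^{1/2}`).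
[folklore] -/
theorem inner_le_rpow_of_comp_sq (S : ℕ → E →L[ℝ] E) (hsym : ∀ m x y, ⟪S m x, y⟫_ℝ = ⟪x, S m y⟫_ℝ)
    (hsq : ∀ m, S m = (S (m + 1)).comp (S (m + 1))) {x : E} (hx : ‖x‖ = 1) (m : ℕ) :
    ⟪S m x, x⟫_ℝ ≤ ⟪S 0 x, x⟫_ℝ ^ ((1 / 2 : ℝ) ^ m) := by
  have hnsq : ∀ m, ⟪S m x, x⟫_ℝ = ‖S (m + 1) x‖ ^ 2 := fun m => by
    conv_lhs => rw [hsq m]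
    rw [ContinuousLinearMap.comp_apply, hsym, real_inner_self_eq_norm_sq]
  have hnn : ∀ m, 0 ≤ ⟪S m x, x⟫_ℝ := fun m => by rw [hnsq m]; positivity
  induction m with
  | zero => simp
  | succ m ih =>
    have h1 : ⟪S (m + 1) x, x⟫_ℝ ≤ ‖S (m + 1) x‖ := by
      simpa [hx] using real_inner_le_norm (S (m + 1) x) x
    have h2 : ‖S (m + 1) x‖ = Real.sqrt ⟪S m x, x⟫_ℝ := by rw [hnsq m, Real.sqrt_sq (norm_nonneg _)]
    calc ⟪S (m + 1) x, x⟫_ℝ ≤ Real.sqrt ⟪S m x, x⟫_ℝ := h2 ▸ h1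
      _ ≤ Real.sqrt (⟪S 0 x, x⟫_ℝ ^ ((1 / 2 : ℝ) ^ m)) := Real.sqrt_le_sqrt ih
      _ = ⟪S 0 x, x⟫_ℝ ^ ((1 / 2 : ℝ) ^ (m + 1)) := by
          rw [Real.sqrt_eq_rpow, ← Real.rpow_mul (hnn 0), pow_succ]

end Abstract

/-! ### Periodic `L²(cell)` functions as classes: inner products with the semigroup -/

variable {L : ℝ} {v : ℝ → ℝ≥0∞}

/-- For periodic real `f, g ∈ L²(cell)` (as classes `[f], [g]`) and `t > 0`:
`⟪e^{-tH}[f], [g]⟫ = ∫_cell g · pfkReal v L t f` (the class of `f` is read through the periodic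
extension of its representative, which is `f` up to a null set of `(ℝ³)^N`). [folklore] -/
theorem inner_pfkL2_toLp_toLp (hv : Measurable v) (hL : 0 < L) {t : ℝ} (ht : 0 < t)
    {f g : Config N → ℝ} (hf : MemLp f 2 (volume.restrict (cellN N L)))
    (hg : MemLp g 2 (volume.restrict (cellN N L)))
    (hfper : ∀ (X : Config N) (i : Fin N) (k : Fin 3),
      f (X + Pi.single i (EuclideanSpace.single k L)) = f X) :
    ⟪pfkL2 v L t (hf.toLp f), hg.toLp g⟫_ℝ = ∫ X in cellN N L, g X * pfkReal v L t f X := by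
  rw [inner_Lp_eq_integral]
  refine integral_congr_ae ?_
  filter_upwards [pfkL2_coeFn hv hL ht (hf.toLp f), hg.coeFn_toLp] with X hX hgX
  rw [hX, hgX, pfkReal_comp_cellProj_congr_ae v hL ht hf.coeFn_toLp X, comp_cellProj_eq_self hfper,
    mul_comm]

/-- `⟪[f], [g]⟫ = ∫_cell f g` for real `f, g ∈ L²(cell)`. [folklore] -/
theorem inner_toLp_toLp_real {f g : Config N → ℝ} (hf : MemLp f 2 (volume.restrict (cellN N L)))
    (hg : MemLp g 2 (volume.restrict (cellN N L))) :
    ⟪hf.toLp f, hg.toLp g⟫_ℝ = ∫ X in cellN N L, f X * g X := by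
  rw [inner_Lp_eq_integral]
  refine integral_congr_ae ?_
  filter_upwards [hf.coeFn_toLp, hg.coeFn_toLp] with X hfX hgX
  rw [hfX, hgX]

/-- `‖[f]‖² = ∫_cell f²` for real `f ∈ L²(cell)`. [folklore] -/
theorem norm_toLp_sq_real {f : Config N → ℝ} (hf : MemLp f 2 (volume.restrict (cellN N L))) :
    ‖hf.toLp f‖ ^ 2 = ∫ X in cellN N L, f X ^ 2 := by
  rw [← real_inner_self_eq_norm_sq, inner_toLp_toLp_real hf hf]
  exact integral_congr_ae (Eventually.of_forall fun X => (sq (f X)).symm)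

/-- A periodic `C¹` real function is in `L²(cell)` (`L > 0`). [folklore] -/
theorem memLp_two_cellN_of_contDiff_periodic (hL : 0 < L) {f : Config N → ℝ} (hf : ContDiff ℝ 1 f)
    (hper : ∀ (X : Config N) (i : Fin N) (k : Fin 3),
      f (X + Pi.single i (EuclideanSpace.single k L)) = f X) :
    MemLp f 2 (volume.restrict (cellN N L)) := by
  obtain ⟨M, -, hM⟩ := exists_bound_of_continuous_periodic hL hf.continuous hper
  exact memLp_two_cellN_of_bound L hf.continuous.measurable hM

/-! ### The Feynman–Kac ground state as a unit eigenvector of `e^{-tH}` on `L²(cell)` -/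

namespace IsPeriodicGroundStateFK

variable {Ψ₀ : Config N → ℝ}

/-- `‖Ψ₀‖_{L²(cell)} = 1` for a Feynman–Kac ground state. [folklore] -/
theorem eLpNorm_two_eq_one (h : IsPeriodicGroundStateFK v L Ψ₀) :
    eLpNorm Ψ₀ 2 (volume.restrict (cellN N L)) = 1 := by
  rw [eLpNorm_eq_lintegral_rpow_enorm_toReal two_ne_zero ENNReal.ofNat_ne_top]
  have h1 : ∫⁻ X in cellN N L, ‖Ψ₀ X‖ₑ ^ ((2 : ℝ≥0∞).toReal) = 1 := by
    rw [← h.norm_eq]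
    refine lintegral_congr fun X => ?_
    rw [ENNReal.toReal_ofNat, ENNReal.rpow_two, Real.enorm_of_nonneg (h.nonneg X)]
  rw [h1, ENNReal.one_rpow]

/-- A Feynman–Kac ground state is in `L²(cell)`. [folklore] -/
theorem memLp_two (h : IsPeriodicGroundStateFK v L Ψ₀) : MemLp Ψ₀ 2 (volume.restrict (cellN N L)) :=
  ⟨h.measurable.aestronglyMeasurable, by rw [h.eLpNorm_two_eq_one]; exact ENNReal.one_lt_top⟩

/-- The class `[Ψ₀] ∈ L²(cell)` is a unit vector. [folklore] -/
theorem norm_toLp (h : IsPeriodicGroundStateFK v L Ψ₀) : ‖h.memLp_two.toLp Ψ₀‖ = 1 := by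
  rw [Lp.norm_toLp, h.eLpNorm_two_eq_one, ENNReal.toReal_one]

/-- `∫_cell Ψ₀² = 1` (Bochner form of the normalisation). [folklore] -/
theorem setIntegral_sq (h : IsPeriodicGroundStateFK v L Ψ₀) : ∫ X in cellN N L, Ψ₀ X ^ 2 = 1 := by
  rw [← norm_toLp_sq_real h.memLp_two, h.norm_toLp, one_pow]

/-- **`[Ψ₀]` is an eigenvector of `e^{-tH}` on `L²(cell)` for `e^{-E₀t}`** (`t > 0`), the structure's
pointwise eigen-relation read on classes. [folklore] -/
theorem pfkL2_toLp (h : IsPeriodicGroundStateFK v L Ψ₀) (hv : Measurable v) (hL : 0 < L) {t : ℝ}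
    (ht : 0 < t) :
    pfkL2 v L t (h.memLp_two.toLp Ψ₀) =
      Real.exp (-((periodicGroundStateEnergy v N L).toReal * t)) • h.memLp_two.toLp Ψ₀ := by
  refine Lp.ext ?_
  filter_upwards [pfkL2_coeFn hv hL ht (h.memLp_two.toLp Ψ₀),
    Lp.coeFn_smul (Real.exp (-((periodicGroundStateEnergy v N L).toReal * t))) (h.memLp_two.toLp Ψ₀),
    h.memLp_two.coeFn_toLp] with X hX hsX h0X
  rw [hX, hsX, Pi.smul_apply, h0X, smul_eq_mul,
    pfkReal_comp_cellProj_congr_ae v hL ht h.memLp_two.coeFn_toLp X, comp_cellProj_eq_self h.periodic,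
    pfkReal_eq_toReal_periodicFKSemigroup hv L t h.measurable h.nonneg X, h.eigen t ht.le X,
    ENNReal.toReal_ofReal (mul_nonneg (Real.exp_pos _).le (h.nonneg X))]

/-- **`‖e^{-tH}‖ = e^{-E₀t}` and the `e^{-E₀t}`-eigenspace is `ℝ[Ψ₀]`** (`t > 0`, `v^per` bounded): the
Perron–Frobenius vector of the compact positivity-improving `e^{-tH}` (a.e. `> 0`, spanning the top
eigenspace) pairs strictly positively with `[Ψ₀] ≥ 0`, so the two eigenvalues coincide.
[cite: ReedSimonIV1978, Thm XIII.44] -/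
theorem opNorm_pfkL2 (h : IsPeriodicGroundStateFK v L Ψ₀) (hv : Measurable v) (hL : 0 < L)
    {C : ℝ≥0} (hC : ∀ x, periodizedPotential v L x ≤ C) {t : ℝ} (ht : 0 < t) :
    ‖(pfkL2 v L t : Lp ℝ 2 (volume.restrict (cellN N L)) →L[ℝ] _)‖ =
        Real.exp (-((periodicGroundStateEnergy v N L).toReal * t)) ∧
      ∀ f : Lp ℝ 2 (volume.restrict (cellN N L)),
        pfkL2 v L t f = ‖(pfkL2 v L t : Lp ℝ 2 (volume.restrict (cellN N L)) →L[ℝ] _)‖ • f →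
          ∃ c : ℝ, f = c • h.memLp_two.toLp Ψ₀ := by
  set μ : Measure (Config N) := volume.restrict (cellN N L) with hμ
  set T : Lp ℝ 2 μ →L[ℝ] Lp ℝ 2 μ := pfkL2 v L t with hT
  set ψ₀ : Lp ℝ 2 μ := h.memLp_two.toLp Ψ₀ with hψ₀
  set c₀ : ℝ := Real.exp (-((periodicGroundStateEnergy v N L).toReal * t)) with hc₀
  have hψ1 : ‖ψ₀‖ = 1 := h.norm_toLp
  have hTψ : T ψ₀ = c₀ • ψ₀ := h.pfkL2_toLp hv hL ht
  obtain ⟨-, e, he1, -, hTe, hepos, hsimple⟩ := pfkL2_perronFrobenius (N := N) hv hL hC ht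
  -- `⟪ψ₀, e⟫ ≠ 0`
  have hkey : ⟪ψ₀, e⟫_ℝ ≠ 0 := by
    intro h0
    rw [inner_Lp_eq_integral] at h0
    have h0ae : (ψ₀ : Config N → ℝ) =ᵐ[μ] Ψ₀ := h.memLp_two.coeFn_toLp
    have hnn : 0 ≤ᵐ[μ] fun X => ψ₀ X * e X := by
      filter_upwards [h0ae, hepos] with X h1 h2
      rw [Pi.zero_apply, h1]
      exact mul_nonneg (h.nonneg X) h2.le
    have hint : Integrable (fun X => ψ₀ X * e X) μ := (Lp.memLp ψ₀).integrable_mul (Lp.memLp e)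
    have hae := (integral_eq_zero_iff_of_nonneg_ae hnn hint).1 h0
    have hψae : (ψ₀ : Config N → ℝ) =ᵐ[μ] 0 := by
      filter_upwards [hae, hepos] with X h1 h2
      exact (mul_eq_zero.1 h1).resolve_right h2.ne'
    rw [Lp.eq_zero_iff_ae_eq_zero.2 hψae, norm_zero] at hψ1
    exact zero_ne_one hψ1
  -- `c₀ = ‖T‖`
  have hle : c₀ ≤ ‖T‖ := by
    have h1 := rayleigh_le_opNorm T hψ1
    rw [hTψ, inner_smul_left, real_inner_self_eq_norm_sq, hψ1, one_pow] at h1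
    simpa using h1
  have hnorm : ‖T‖ = c₀ := by
    by_contra hne
    have h1 : ⟪T ψ₀, e⟫_ℝ = ⟪ψ₀, T e⟫_ℝ := inner_pfkL2_comm hv hL ht ψ₀ e
    rw [hTψ, hTe, inner_smul_left, inner_smul_right] at h1
    have h2 : (‖T‖ - c₀) * ⟪ψ₀, e⟫_ℝ = 0 := by
      simp only [conj_trivial] at h1
      linarith
    exact hkey ((mul_eq_zero.1 h2).resolve_left (sub_ne_zero.2 hne))
  refine ⟨hnorm, fun f hf => ?_⟩
  obtain ⟨c, rfl⟩ := hsimple f hf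
  obtain ⟨c', hc'⟩ := hsimple ψ₀ (by rw [hTψ, hnorm])
  have hc'0 : c' ≠ 0 := by
    rintro rfl
    rw [zero_smul] at hc'; rw [hc', norm_zero] at hψ1; exact zero_ne_one hψ1
  refine ⟨c * c'⁻¹, ?_⟩
  rw [hc', smul_smul, mul_assoc, inv_mul_cancel₀ hc'0, mul_one]

/-- **The spectral gap below the Feynman–Kac ground state on `L²(cell)`** (`t > 0`): there is
`M₁ < e^{-E₀t}` (`M₁ ≥ 0`) with `‖e^{-tH} x‖ ≤ M₁ ‖x‖` for every `x ⊥ [Ψ₀]` (compactness of `e^{-tH}`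
and simplicity of its top eigenvalue, `exists_gap_of_simple`). [cite: ReedSimonIV1978, Thm XIII.44] -/
theorem exists_gap (h : IsPeriodicGroundStateFK v L Ψ₀) (hv : Measurable v) (hL : 0 < L)
    {C : ℝ≥0} (hC : ∀ x, periodizedPotential v L x ≤ C) {t : ℝ} (ht : 0 < t) :
    ∃ M₁ : ℝ, M₁ < Real.exp (-((periodicGroundStateEnergy v N L).toReal * t)) ∧ 0 ≤ M₁ ∧
      ∀ x : Lp ℝ 2 (volume.restrict (cellN N L)), ⟪h.memLp_two.toLp Ψ₀, x⟫_ℝ = 0 →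
        ‖pfkL2 v L t x‖ ≤ M₁ * ‖x‖ := by
  obtain ⟨hnorm, hsimple⟩ := h.opNorm_pfkL2 hv hL hC ht
  obtain ⟨hT0, -⟩ := pfkL2_perronFrobenius (N := N) hv hL hC ht
  have hTψ := h.pfkL2_toLp hv hL ht
  rw [← hnorm] at hTψ ⊢
  exact exists_gap_of_simple _ (inner_pfkL2_comm hv hL ht) (inner_pfkL2_self_nonneg hv hL ht)
    (isCompactOperator_pfkL2 hv hL hC ht) hT0 h.norm_toLp hTψ hsimple

/-- **The two-level Rayleigh bound at dyadic times.** There is `γ > 0` such that for every periodic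
`C¹` real `f` and every `m`, with `t = 2^{-m}` and `a = ⟨Ψ₀, f⟩_cell`:
`⟨f, e^{-tH}f⟩_cell ≤ e^{-E₀t} a² + e^{-(E₀+γ)t} (‖f‖²_cell - a²)` (the gap at `t = 1` transported to
`t = 2^{-m}` by log-convexity, and the splitting `f = aΨ₀ + x`). [cite: ReedSimonIV1978, Thm XIII.44] -/
theorem exists_twoLevel (h : IsPeriodicGroundStateFK v L Ψ₀) (hv : Measurable v) (hL : 0 < L)
    {C : ℝ≥0} (hC : ∀ x, periodizedPotential v L x ≤ C) :
    ∃ γ : ℝ, 0 < γ ∧ ∀ f : Config N → ℝ, ContDiff ℝ 1 f →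
      (∀ (X : Config N) (i : Fin N) (k : Fin 3),
        f (X + Pi.single i (EuclideanSpace.single k L)) = f X) →
      ∀ m : ℕ, ∫ X in cellN N L, f X * pfkReal v L ((1 / 2 : ℝ) ^ m) f X ≤
        Real.exp (-((periodicGroundStateEnergy v N L).toReal * (1 / 2 : ℝ) ^ m)) *
            (∫ X in cellN N L, Ψ₀ X * f X) ^ 2 +
          Real.exp (-(((periodicGroundStateEnergy v N L).toReal + γ) * (1 / 2 : ℝ) ^ m)) *
            ((∫ X in cellN N L, f X ^ 2) - (∫ X in cellN N L, Ψ₀ X * f X) ^ 2) := by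
  set μ : Measure (Config N) := volume.restrict (cellN N L) with hμ
  set E₀ : ℝ := (periodicGroundStateEnergy v N L).toReal with hE₀
  set ψ₀ : Lp ℝ 2 μ := h.memLp_two.toLp Ψ₀ with hψ₀
  set S : ℕ → Lp ℝ 2 μ →L[ℝ] Lp ℝ 2 μ := fun m => pfkL2 v L ((1 / 2 : ℝ) ^ m) with hS
  have htpos : ∀ m : ℕ, (0 : ℝ) < (1 / 2 : ℝ) ^ m := fun m => by positivity
  have hsym : ∀ m x y, ⟪S m x, y⟫_ℝ = ⟪x, S m y⟫_ℝ := fun m x y => inner_pfkL2_comm hv hL (htpos m) x y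
  have hsq : ∀ m, S m = (S (m + 1)).comp (S (m + 1)) := fun m => by
    have := pfkL2_eq_comp_half (N := N) hv hL (htpos m)
    rw [hS]
    dsimp only
    rw [this, pow_succ]
    congr 2 <;> ring
  -- the gap at `t = 1`
  obtain ⟨M₁, hM₁, hM₁0, hgap⟩ := h.exists_gap hv hL hC one_pos
  rw [mul_one] at hM₁
  set M : ℝ := max M₁ (Real.exp (-E₀) / 2) with hM
  have hMpos : 0 < M := lt_max_of_lt_right (by positivity)
  have hMlt : M < Real.exp (-E₀) := max_lt hM₁ (by linarith [Real.exp_pos (-E₀)])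
  set γ : ℝ := -Real.log M - E₀ with hγ
  have hγpos : 0 < γ := by
    have : Real.log M < -E₀ := (Real.log_lt_iff_lt_exp hMpos).2 hMlt
    rw [hγ]; linarith
  have hexpM : ∀ s : ℝ, Real.exp (-((E₀ + γ) * s)) = M ^ s := fun s => by
    rw [Real.rpow_def_of_pos hMpos, hγ]
    congr 1; ring
  refine ⟨γ, hγpos, fun f hf hper m => ?_⟩
  -- eigen-relation at time `2^{-m}` and the Rayleigh bound on `ψ₀^⊥`
  have hTψ : S m ψ₀ = Real.exp (-(E₀ * (1 / 2 : ℝ) ^ m)) • ψ₀ := h.pfkL2_toLp hv hL (htpos m)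
  have hperp : ∀ x : Lp ℝ 2 μ, ⟪ψ₀, x⟫_ℝ = 0 → ⟪S m x, x⟫_ℝ ≤ M ^ ((1 / 2 : ℝ) ^ m) * ‖x‖ ^ 2 := by
    intro x hx
    by_cases hx0 : x = 0
    · simp [hx0]
    have hn : 0 < ‖x‖ := norm_pos_iff.2 hx0
    set u : Lp ℝ 2 μ := ‖x‖⁻¹ • x with hu
    have hu1 : ‖u‖ = 1 := by rw [hu, norm_smul, norm_inv, norm_norm, inv_mul_cancel₀ hn.ne']
    have hxu : x = ‖x‖ • u := by rw [hu, smul_smul, mul_inv_cancel₀ hn.ne', one_smul]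
    have hu0 : ⟪ψ₀, u⟫_ℝ = 0 := by rw [hu, inner_smul_right, hx, mul_zero]
    -- at `t = 1`: `⟪S 0 u, u⟫ ≤ ‖S 0 u‖ ≤ M₁ ≤ M`
    have h0 : ⟪S 0 u, u⟫_ℝ ≤ M := by
      have h1 : ⟪S 0 u, u⟫_ℝ ≤ ‖S 0 u‖ := by simpa [hu1] using real_inner_le_norm (S 0 u) u
      have h2 : ‖S 0 u‖ ≤ M₁ := by simpa [hS, hu1] using hgap u hu0
      exact h1.trans (h2.trans (le_max_left _ _))
    have hchain := inner_le_rpow_of_comp_sq S hsym hsq hu1 m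
    have hnn0 : 0 ≤ ⟪S 0 u, u⟫_ℝ := by
      rw [hsq 0, ContinuousLinearMap.comp_apply, hsym, real_inner_self_eq_norm_sq]; positivity
    have hmono : ⟪S 0 u, u⟫_ℝ ^ ((1 / 2 : ℝ) ^ m) ≤ M ^ ((1 / 2 : ℝ) ^ m) :=
      Real.rpow_le_rpow hnn0 h0 (htpos m).le
    have h2 : ⟪S m x, x⟫_ℝ = ‖x‖ ^ 2 * ⟪S m u, u⟫_ℝ := by
      conv_lhs => rw [hxu]
      rw [map_smul, inner_smul_left, inner_smul_right]
      simp only [conj_trivial]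
      ring
    rw [h2, mul_comm]
    exact mul_le_mul_of_nonneg_right (hchain.trans hmono) (sq_nonneg _)
  -- the class of `f` and its splitting along `ψ₀`
  have hfm : MemLp f 2 μ := memLp_two_cellN_of_contDiff_periodic hL hf hper
  set φ : Lp ℝ 2 μ := hfm.toLp f with hφ
  obtain ⟨hsplit, hx0, hxn⟩ := inner_map_self_eq_of_eigenvector (S m) (hsym m) h.norm_toLp hTψ φ
  have hpair : ∫ X in cellN N L, f X * pfkReal v L ((1 / 2 : ℝ) ^ m) f X = ⟪S m φ, φ⟫_ℝ :=
    (inner_pfkL2_toLp_toLp hv hL (htpos m) hfm hfm hper).symm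
  have ha : ⟪ψ₀, φ⟫_ℝ = ∫ X in cellN N L, Ψ₀ X * f X := inner_toLp_toLp_real h.memLp_two hfm
  have hn : ‖φ‖ ^ 2 = ∫ X in cellN N L, f X ^ 2 := norm_toLp_sq_real hfm
  rw [hpair, hsplit, ← ha, ← hn, hexpM, ← hxn]
  exact add_le_add le_rfl (hperp _ hx0)

/-- **The Ky Fan gap from a Feynman–Kac ground state.** For measurable `v` with bounded
periodisation `v^per ≤ C` on the torus of side `L > 0`, a Feynman–Kac ground state `Ψ₀`
(`IsPeriodicGroundStateFK v L Ψ₀`) forces `2E₀ + γ ≤ kyFanTwo v N L` for some `γ > 0`,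
`E₀ = periodicGroundStateEnergy v N L`: the periodic ground state is nondegenerate with a spectral
gap, in the tree's variational (Ky Fan) vocabulary. Reed–Simon IV §XIII.12 (positivity improving +
compact resolvent ⇒ simple ground state; the bosonic ground state is the absolute one) with the
min–max principle Thm XIII.1–2. [cite: ReedSimonIV1978, Thm XIII.44 and Thm. XIII.1–2] -/
theorem exists_kyFanGap (h : IsPeriodicGroundStateFK v L Ψ₀) (hv : Measurable v) (hL : 0 < L)
    {C : ℝ≥0} (hC : ∀ x, periodizedPotential v L x ≤ C) :
    ∃ γ : ℝ, 0 < γ ∧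
      2 * periodicGroundStateEnergy v N L + ENNReal.ofReal γ ≤ kyFanTwo v N L := by
  obtain ⟨γ, hγ, htwo⟩ := h.exists_twoLevel hv hL hC
  refine ⟨γ, hγ, ?_⟩
  have hK := ofReal_le_kyFanTwo_of_twoLevel hL hv hC hγ.le h.memLp_two h.setIntegral_sq.le
    (fun m => by positivity) (tendsto_pow_atTop_nhds_zero_of_lt_one (by norm_num) (by norm_num)) htwo
  have hE : periodicGroundStateEnergy v N L = ENNReal.ofReal (periodicGroundStateEnergy v N L).toReal :=
    (ENNReal.ofReal_toReal h.energy_ne_top).symm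
  calc 2 * periodicGroundStateEnergy v N L + ENNReal.ofReal γ
      = ENNReal.ofReal (2 * (periodicGroundStateEnergy v N L).toReal + γ) := by
        rw [ENNReal.ofReal_add (by positivity) hγ.le, ENNReal.ofReal_mul zero_le_two,
          ENNReal.ofReal_ofNat, ← hE]
    _ ≤ kyFanTwo v N L := hK

end IsPeriodicGroundStateFK

/-! ### Consequences for the named facts -/

/-- **Ky Fan gap under `PeriodicGroundStateFeynmanKac`**: for `N ≥ 1`, `L > 0`, measurable `v` with
bounded periodisation, `2E₀ + γ ≤ kyFanTwo v N L` for some `γ > 0`.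
[cite: ReedSimonIV1978, Thm XIII.44 and Thm. XIII.1–2] -/
theorem exists_kyFanGap_of_periodicGroundStateFeynmanKac (hGS : PeriodicGroundStateFeynmanKac)
    (hN : 1 ≤ N) (hL : 0 < L) (hv : Measurable v) (hb : ∃ C : ℝ≥0, ∀ x, periodizedPotential v L x ≤ C) :
    ∃ γ : ℝ, 0 < γ ∧
      2 * periodicGroundStateEnergy v N L + ENNReal.ofReal γ ≤ kyFanTwo v N L := by
  obtain ⟨Ψ₀, hΨ, -, -⟩ := hGS N L v hN hL hv hb
  obtain ⟨C, hC⟩ := hb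
  exact hΨ.exists_kyFanGap hv hL hC

/-- **`PeriodicGroundStateFeynmanKac` implies `PeriodicGroundStateNondegenerate`**: the Feynman–Kac
package for bounded periodised potentials (Chung–Zhao §3.2 / Reed–Simon IV Thm XIII.44) yields the
simplicity of the bosonic ground state in Ky Fan form, `2E₀ < kyFanTwo v N L`
(Reed–Simon IV §XIII.12, remark after the Corollary to Thm XIII.46).
[cite: ReedSimonIV1978, §XIII.12 Thms XIII.43–XIII.45 and remark after Cor. to Thm XIII.46] -/
theorem periodicGroundStateNondegenerate_of_periodicGroundStateFeynmanKac
    (hGS : PeriodicGroundStateFeynmanKac) :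
    Literature.MathematicalPhysics.QuantumManyBody.PeriodicGroundStateNondegenerate := by
  intro N L v hN hL hv hb
  obtain ⟨Ψ₀, hΨ, -, -⟩ := hGS N L v hN hL hv hb
  obtain ⟨C, hC⟩ := hb
  obtain ⟨γ, hγ, hle⟩ := hΨ.exists_kyFanGap hv hL hC
  have h2 : 2 * periodicGroundStateEnergy v N L ≠ ⊤ :=
    ENNReal.mul_ne_top ENNReal.ofNat_ne_top hΨ.energy_ne_top
  calc 2 * periodicGroundStateEnergy v N L
      < 2 * periodicGroundStateEnergy v N L + ENNReal.ofReal γ :=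
        ENNReal.lt_add_right h2 (ENNReal.ofReal_pos.2 hγ).ne'
    _ ≤ kyFanTwo v N L := hle

end Literature.MathematicalPhysics.QuantumManyBody.BoseGas

end
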